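import Summits.AtomisticToContinuum.BoseEinsteinCondensation.Theses.BECInfraredBound
import Literature.MathematicalPhysics.QuantumManyBody.FreeDirichletGap
import Literature.MathematicalPhysics.QuantumManyBody.CondensateOccupationStability
import Literature.MathematicalPhysics.QuantumManyBody.JelliumBoseGasCondensateDilation
import Literature.MathematicalPhysics.QuantumManyBody.BoseGasFreeProductState
import Literature.MathematicalPhysics.QuantumManyBody.BoseGasFreeDirichletBEC
import Literature.MathematicalPhysics.QuantumManyBody.ThermalExpectation

/-!
# Crux `BecFreeGas` (stmt-AtomisticToContinuum-8912) — crux-ideate r1 k1: first lemmas of two ideas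

Scratch file (elaboration check only). `Ideas.RayRigidity.*` = idea `nbody-ray-rigidity`;
`Ideas.FlatCoercivity.*` = idea `flat-mode-coercivity`. All constants are existing declarations.
-/

noncomputable section

namespace Summit.AtomisticToContinuum.BoseEinsteinCondensation.Cruxes.BecFreeGas.Ideas

open MeasureTheory Filter
open scoped ENNReal NNReal ComplexConjugate
open Literature.MathematicalPhysics.QuantumManyBody.BoseGas

/-- The crux's flat mode is literally the tree's `boxConstantMode`. -/
example (L : ℝ) : boxConstantMode L = (box L).indicator fun _ => ((Real.sqrt (L ^ 3))⁻¹ : ℂ) := rfl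

/-- The normalised free Dirichlet ground state `Ψ₀ = 1_{Λ^N} ∏ᵢ∏ₖ (2/L)^{1/2} sin(πX_{ik}/L)`
(the `Ψ₀` of `freeDirichletGap`, written out). -/
def freeGS (N : ℕ) (L : ℝ) : Config N → ℂ :=
  (boxN N L).indicator fun X : Config N =>
    ∏ i : Fin N, ∏ k : Fin 3, ((Real.sqrt (2 / L) * Real.sin (Real.pi * X i k / L) : ℝ) : ℂ)

namespace RayRigidity

/-- FIRST LEMMA (idea A, step 1): the SHARP free upper bound for every `L > 0` —
`groundStateEnergy_zero_le_of_ge` (all `η > 0`, `L ≥ L₀(η)`) made `η`-free and `L₀`-free by the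
dilation covariance `groundStateEnergy_dilate` (`L² E₀(0,N,L)` does not depend on `L`). -/
def SharpFreeUpperBound : Prop :=
  ∀ (N : ℕ) (L : ℝ), 0 < L →
    groundStateEnergy 0 N L ≤ ENNReal.ofReal (3 * N * Real.pi ^ 2 / L ^ 2)

/-- Step 2 (pure computation): the flat-mode occupation of the free ground state is
`N · ((8/π²)^{3/2})² = N (8/π²)³` (`∫₀ᴸ (2/L)^{1/2} sin(πt/L) dt · L^{-1/2} = (8/π²)^{1/2}` per axis). -/
def FlatOccupationFreeGS : Prop :=
  ∀ (N : ℕ) (L : ℝ), 1 ≤ N → 0 < L →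
    occupation N (boxConstantMode L) (freeGS N L) = ENNReal.ofReal (N * (8 / Real.pi ^ 2) ^ 3)

/-- Step 3 (the lever, seminorm transfer along the ray of `Ψ₀`): a normalised continuous `N`-body
function within `L²`-distance² `1/16` of `α Ψ₀`, `α = ⟨Ψ₀, Ψ⟩`, has flat-mode occupation `≥ N/8`
(`√n(Ψ) ≥ |α|√(N(8/π²)³) - √(N/16)`, `|α|² = 1 - ‖Ψ - αΨ₀‖²`; numerically `(√(15p/16) - 1/4)² N ≈ 0.208 N ≥ N/8`, needs only `π < 3.2`). -/
def RayToFlat : Prop :=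
  ∀ (N : ℕ) (L : ℝ), 1 ≤ N → 0 < L → ∀ Ψ : TrialState N L,
    ∫⁻ X, (‖Ψ.ψ X - (∫ Y, conj (freeGS N L Y) * Ψ.ψ Y) * freeGS N L X‖₊ : ℝ≥0∞) ^ 2 ≤
        ENNReal.ofReal (1 / 16) →
      ENNReal.ofReal (N / 8) ≤ occupation N (boxConstantMode L) Ψ.ψ

/-- How the three steps give the crux at fixed `(N, L)` with the NON-extensive slack
`δ = 3π²/(16 L²)`: `freeDirichletGap` + `SharpFreeUpperBound` turn `energy 0 Ψ ≤ E₀ + δ` into the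
hypothesis of `RayToFlat`. -/
def FixedBoxConclusion : Prop :=
  ∀ (N : ℕ) (L : ℝ), 1 ≤ N → 0 < L → ∀ Ψ : TrialState N L,
    energy 0 Ψ ≤ groundStateEnergy 0 N L + ENNReal.ofReal (3 * Real.pi ^ 2 / (16 * L ^ 2)) →
      ENNReal.ofReal (N / 8) ≤ occupation N (boxConstantMode L) Ψ.ψ

/-- PROOF of the first lemma of idea A (de-risking the load-bearing sharpening): the tree's
`η`-relative bound at all large boxes, pulled back to every box by dilation covariance, then
`η → 0`. -/
theorem sharpFreeUpperBound : SharpFreeUpperBound := by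
  intro N L hL
  -- (1) every `η > 0`, every `L > 0`
  have key : ∀ η : ℝ, 0 < η →
      groundStateEnergy 0 N L ≤ ENNReal.ofReal (3 * N * (Real.pi / L) ^ 2 * (1 + η)) := by
    intro η hη
    obtain ⟨L₀, hL₀, H⟩ := groundStateEnergy_zero_le_of_ge hη
    set s : ℝ := max 1 (L₀ / L) with hs_def
    have hs : 0 < s := lt_of_lt_of_le one_pos (le_max_left _ _)
    have hsL : L₀ ≤ s * L := by
      have h1 : L₀ / L ≤ s := le_max_right _ _
      calc L₀ = (L₀ / L) * L := by field_simp
        _ ≤ s * L := by gcongr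
    have hup := H (s * L) hsL N
    have hdil :=
      Literature.MathematicalPhysics.QuantumManyBody.JelliumBoseGas.groundStateEnergy_dilate 0 N L hs
    rw [scalePotential_zero] at hdil
    calc groundStateEnergy 0 N L
        = ENNReal.ofReal (s ^ 2) * (ENNReal.ofReal (s ^ 2)⁻¹ * groundStateEnergy 0 N L) := by
          rw [← mul_assoc, ← ENNReal.ofReal_mul (by positivity),
            mul_inv_cancel₀ (by positivity : s ^ 2 ≠ 0), ENNReal.ofReal_one, one_mul]
      _ = ENNReal.ofReal (s ^ 2) * groundStateEnergy 0 N (s * L) := by rw [hdil]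
      _ ≤ ENNReal.ofReal (s ^ 2) * ENNReal.ofReal (3 * N * (Real.pi / (s * L)) ^ 2 * (1 + η)) := by
          gcongr
      _ = ENNReal.ofReal (3 * N * (Real.pi / L) ^ 2 * (1 + η)) := by
          rw [← ENNReal.ofReal_mul (by positivity)]
          congr 1
          field_simp
  -- (2) `η → 0`
  refine ENNReal.le_of_forall_pos_le_add fun ε hε _ => ?_
  set a : ℝ := 3 * N * (Real.pi / L) ^ 2 with ha
  have ha0 : 0 ≤ a := by positivity
  have hη : 0 < (ε : ℝ) / (a + 1) := by positivity
  have h1 : a * (1 + ε / (a + 1)) ≤ 3 * N * Real.pi ^ 2 / L ^ 2 + ε := by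
    have hEq : a = 3 * N * Real.pi ^ 2 / L ^ 2 := by rw [ha]; field_simp
    have h2 : a * (ε / (a + 1)) ≤ ε := by
      rw [mul_div_assoc', div_le_iff₀ (by positivity)]
      nlinarith [NNReal.coe_nonneg ε]
    nlinarith [h2]
  calc groundStateEnergy 0 N L ≤ ENNReal.ofReal (a * (1 + ε / (a + 1))) := key _ hη
    _ ≤ ENNReal.ofReal (3 * N * Real.pi ^ 2 / L ^ 2 + ε) := ENNReal.ofReal_le_ofReal h1
    _ = ENNReal.ofReal (3 * N * Real.pi ^ 2 / L ^ 2) + ENNReal.ofReal (ε : ℝ) :=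
        ENNReal.ofReal_add (by positivity) (NNReal.coe_nonneg ε)
    _ = ENNReal.ofReal (3 * N * Real.pi ^ 2 / L ^ 2) + ε := by rw [ENNReal.ofReal_coe_nnreal]

/-- The cancellation behind `FixedBoxConclusion`: `freeDirichletGap` + `sharpFreeUpperBound` turn
`energy 0 Ψ ≤ E₀ + 3π²/(16L²)` into `‖Ψ - αΨ₀‖² ≤ 1/16` (all quantities finite in `ℝ≥0∞`). -/
theorem fixedBox_of_rayToFlat (h : RayToFlat) : FixedBoxConclusion := by
  intro N L hN hL Ψ hΨ
  refine h N L hN hL Ψ ?_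
  have hgap := freeDirichletGap hN hL Ψ
  have hsharp := sharpFreeUpperBound N L hL
  have h1 : ENNReal.ofReal (3 * N * Real.pi ^ 2 / L ^ 2) + ENNReal.ofReal (3 * Real.pi ^ 2 / L ^ 2) *
        (∫⁻ X, (‖Ψ.ψ X - (∫ Y, conj (freeGS N L Y) * Ψ.ψ Y) * freeGS N L X‖₊ : ℝ≥0∞) ^ 2) ≤
      ENNReal.ofReal (3 * N * Real.pi ^ 2 / L ^ 2) +
        ENNReal.ofReal (3 * Real.pi ^ 2 / L ^ 2) * ENNReal.ofReal (1 / 16) := by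
    calc _ ≤ energy 0 Ψ := hgap
      _ ≤ groundStateEnergy 0 N L + ENNReal.ofReal (3 * Real.pi ^ 2 / (16 * L ^ 2)) := hΨ
      _ ≤ _ := by
        rw [← ENNReal.ofReal_mul (by positivity)]
        refine add_le_add hsharp (le_of_eq ?_)
        congr 1
        ring
  have h2 := ENNReal.le_of_add_le_add_left ENNReal.ofReal_ne_top h1
  exact (ENNReal.mul_le_mul_iff_right (ENNReal.ofReal_pos.mpr (by positivity)).ne' ENNReal.ofReal_ne_top).mp h2

end RayRigidity

namespace FlatCoercivity

/-- `p = (8/π²)³ = 512/π⁶ ≈ 0.533`, the squared overlap of the flat mode with the sine ground mode. -/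
def p : ℝ := 512 / Real.pi ^ 6

/-- FIRST LEMMA (idea B): ONE-BODY FLAT-MODE COERCIVITY of the Dirichlet form on `Λ_L`:
`6p λ ‖f‖² ≤ ∫|∇f|² + 6(2p-1) λ |⟨φ_L, f⟩|²`, `λ = (π/L)²`, `φ_L = boxConstantMode L`, for `C¹`
`f` vanishing off the open box (from the cube gap `DirichletBox.gap_mul_lintegral_enorm_sq_le_pi`,
`6λ‖f‖² ≤ ∫|∇f|² + 3λ|⟨S,f⟩|²`, and the quadratic transfer
`|⟨S,f⟩|² ≤ 2p|⟨φ_L,f⟩|² + 2(1-p)(‖f‖² - |⟨φ_L,f⟩|²)`, `S = ` sine ground mode, `⟨φ_L, S⟩² = p`).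
Since `6p > 3`, the flat mode has an EFFECTIVE GAP above the ground level `3λ`. -/
def OneBody : Prop :=
  ∀ (L : ℝ), 0 < L → ∀ f : Space → ℂ, ContDiff ℝ 1 f → (∀ x, x ∉ box L → f x = 0) →
    ENNReal.ofReal (6 * p * (Real.pi / L) ^ 2) * ∫⁻ x, (‖f x‖₊ : ℝ≥0∞) ^ 2 ≤
      (∫⁻ x, gradSqC f x) +
        ENNReal.ofReal (6 * (2 * p - 1) * (Real.pi / L) ^ 2) *
          (‖∫ x, conj (boxConstantMode L x) * f x‖₊ : ℝ≥0∞) ^ 2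

/-- Its Bose-symmetric lift (template `BoseGasFreeDirichletBEC.key_inequality`: slice
`x ↦ Ψ(x, Y)`, integrate `dY`, multiply by `N` via `lintegral_kineticDensity_eq_mul`):
`6p λ N ≤ T(Ψ) + 6(2p-1) λ n_{φ_L}(Ψ)`. With `T ≤ 3λN(1+η) + δ` this gives
`n_{φ_L} ≥ [(6p - 3 - 3η)λN - δ] / (6(2p-1)λ)`, i.e. BEC robust to an EXTENSIVE slack `δ ∝ λN`. -/
def Lifted : Prop :=
  ∀ (N : ℕ) (L : ℝ), 0 < L → ∀ Ψ : TrialState N L,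
    ENNReal.ofReal (6 * p * (Real.pi / L) ^ 2 * N) ≤
      energy 0 Ψ +
        ENNReal.ofReal (6 * (2 * p - 1) * (Real.pi / L) ^ 2) * occupation N (boxConstantMode L) Ψ.ψ

end FlatCoercivity

/-! Sanity: the tree facts the ideas lean on, by name. -/
#check @freeDirichletGap
#check @Literature.MathematicalPhysics.QuantumManyBody.JelliumBoseGas.groundStateEnergy_dilate
#check @scalePotential_zero
#check @groundStateEnergy_zero_le_of_ge
#check @condensateOccupation_rpow_half_le_add
#check @condensateOccupation_le_card_mul_lintegral
#check @occupation_const_mul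
#check @Literature.MathematicalPhysics.QuantumManyBody.DirichletBox.gap_mul_lintegral_enorm_sq_le_pi
#check @Literature.MathematicalPhysics.QuantumManyBody.DirichletBox.lintegral_enorm_sq_sub_inner_mul
#check @lintegral_kineticDensity_eq_mul
#check @contDiff_vecCons_slice
#check @key_inequality
#check @lintegral_enorm_sq_freeGroundState

end Summit.AtomisticToContinuum.BoseEinsteinCondensation.Cruxes.BecFreeGas.Ideas

end
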